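import Literature.Probability.Percolation.SelfRefinementMeasure
import Literature.Probability.Percolation.KohlerSchindlerTassionRSW
import Summits.CriticalPhenomena.CardyFormulaZ2.Theorems.CardySelfRefinementCriticalPathRSWStubCone3GraphA
import Summits.CriticalPhenomena.CardyFormulaZ2.Theorems.CardySelfRefinementCriticalPathRSWStubCone3Model

/-!
# Stub `stub_cone3` of line `finite-size-envelope` (crux `CriticalPathRSW`), part 5:
local combinatorics of a tuple, I — neighbours in the frame, the two-sided case, the chain lemma

Support file for item `stmt-CriticalPhenomena-10267` (stub `stub_cone3`).  Fix a box
`B = [-M, M] × [-N, N]` with sides `L = {x₀ = -M}`, `R = {x₀ = M}`, and a tuple `(b, d)` of `M_3`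
in its frame `pt⟪α, β⟫ = 3b + α e_d + β e_{d'}` (vertices `u, m₁, m₂, w = pt⟪0..3, 0⟫`, sub-edges
`T = {(pt⟪j, 0⟫, d)}`, and the four interior labels `F` at `m₁, m₂` in direction `d'`).  For a set
`V` of open labels NOT containing the sub-edges (the tuple closed) we prove:

* the neighbours of a frame point through open labels (`Cone3.nbr_pt`), whence: the interior
  vertices `m₁, m₂` have no neighbour once `T ∪ F` is closed, and the "ports" of `u`;
* **the two-sided case** (`Cone3.two_sided_of_joined`): if `V ⊉ T ∪ F`-closed configuration `V⁰`
  does not join the sides but `V⁰ ∪ T` does, then `u ↔ L, w ↔ R` (or the mirror) in `V⁰`; and in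
  that case opening a PROPER subset of `T` never joins the sides (`Cone3.not_joined_of_two_sided`);
* the abstract **chain lemma** on a finite set (`Cone3.exists_flip_of_chain`).

Everything is elementary (Grimmett 1999 §2.4; Aizenman–Grimmett 1991 §3, local surgery).
-/

noncomputable section

namespace Summit.CriticalPhenomena.CardyFormulaZ2.Cruxes.CriticalPathRSW.FiniteSizeEnvelope

open Set
open Literature.Probability.LatticeModels Literature.Probability.Percolation

namespace Cone3

variable {M N : ℕ} {b : Site 2} {d d' : Fin 2}

set_option quotPrecheck false

/-- The local frame of the tuple `(b, d)`: `pt⟪α, β⟫ = 3b + α e_d + β e_{d'}`. -/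
local notation "pt⟪" α ", " β "⟫" =>
  ((3 : ℤ) • b + (α : ℤ) • (Pi.single d (1 : ℤ) : Site 2) + (β : ℤ) • (Pi.single d' (1 : ℤ) : Site 2))

/-- Neighbours of `a` through an open label of `U`, inside `B`. -/
local notation "nbr⟪" B ", " U ", " a "⟫" =>
  {b : Site 2 | a ∈ B ∧ b ∈ B ∧ ∃ d : Fin 2,
    (b = a + Pi.single d 1 ∧ (a, d) ∈ U) ∨ (a = b + Pi.single d 1 ∧ (b, d) ∈ U)}

/-- The open cluster of `a` inside `B`. -/
local notation "clus⟪" B ", " U ", " a "⟫" =>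
  {b : Site 2 | Relation.ReflTransGen (fun x y : Site 2 => y ∈ nbr⟪B, U, x⟫) a b}

/-- The vertices joined inside `B` to the side `L`. -/
local notation "side⟪" B ", " U ", " L "⟫" => {v : Site 2 | ∃ a ∈ L, v ∈ clus⟪B, U, a⟫}

/-- The label configurations joining `L` to `R` inside `B`. -/
local notation "joined⟪" B ", " L ", " R "⟫" =>
  {U : Set (Site 2 × Fin 2) | ∃ a ∈ L, ∃ b ∈ R, b ∈ clus⟪B, U, a⟫}

/-- The box. -/
local notation "Bx" => (KST2023.box M N)

/-- Its left side. -/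
local notation "Lx" => {x : Site 2 | x ∈ KST2023.box M N ∧ x 0 = -(M : ℤ)}

/-- Its right side. -/
local notation "Rx" => {x : Site 2 | x ∈ KST2023.box M N ∧ x 0 = (M : ℤ)}

/-- The three sub-edges of the tuple. -/
local notation "Tl" =>
  ({(pt⟪0, 0⟫, d), (pt⟪1, 0⟫, d), (pt⟪2, 0⟫, d)} : Set (Site 2 × Fin 2))

/-- The four interior labels at the interior vertices of the tuple. -/
local notation "Fl" =>
  ({(pt⟪1, 0⟫, d'), (pt⟪1, -1⟫, d'), (pt⟪2, 0⟫, d'), (pt⟪2, -1⟫, d')} : Set (Site 2 × Fin 2))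

/-! ### Neighbours in the frame -/

/-- `pt⟪α, β⟫ - e_d = pt⟪α - 1, β⟫`, in the form used by adjacencies. -/
theorem pt_eq_add_single_d (hd : d' ≠ d) (α β : ℤ) : pt⟪α, β⟫ = pt⟪α - 1, β⟫ + Pi.single d 1 := by
  rw [pt_add_single_d hd, sub_add_cancel]

/-- `pt⟪α, β⟫ - e_{d'} = pt⟪α, β - 1⟫`, in the form used by adjacencies. -/
theorem pt_eq_add_single_d' (hd : d' ≠ d) (α β : ℤ) : pt⟪α, β⟫ = pt⟪α, β - 1⟫ + Pi.single d' 1 := by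
  rw [pt_add_single_d' hd, sub_add_cancel]

/-- **The neighbours of a frame point**: through the label based at it or ending at it, in
direction `d` or `d'`. -/
theorem nbr_pt (hd : d' ≠ d) {U : Set (Site 2 × Fin 2)} {α β : ℤ} {y : Site 2}
    (h : y ∈ nbr⟪Bx, U, pt⟪α, β⟫⟫) :
    ((pt⟪α, β⟫, d) ∈ U ∧ y = pt⟪α + 1, β⟫) ∨ ((pt⟪α - 1, β⟫, d) ∈ U ∧ y = pt⟪α - 1, β⟫) ∨
      ((pt⟪α, β⟫, d') ∈ U ∧ y = pt⟪α, β + 1⟫) ∨ ((pt⟪α, β - 1⟫, d') ∈ U ∧ y = pt⟪α, β - 1⟫) := by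
  obtain ⟨-, -, d₀, h⟩ := h
  rcases fin2_eq_or hd d₀ with h0 | h0 <;> rw [h0] at h
  · rcases h with ⟨h1, h2⟩ | ⟨h1, h2⟩
    · exact Or.inl ⟨h2, by rw [h1, pt_add_single_d hd]⟩
    · have hy : y = pt⟪α - 1, β⟫ := add_right_cancel (h1.symm.trans (pt_eq_add_single_d hd α β))
      refine Or.inr (Or.inl ⟨?_, hy⟩)
      rw [← hy]; exact h2
  · rcases h with ⟨h1, h2⟩ | ⟨h1, h2⟩
    · exact Or.inr (Or.inr (Or.inl ⟨h2, by rw [h1, pt_add_single_d' hd]⟩))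
    · have hy : y = pt⟪α, β - 1⟫ := add_right_cancel (h1.symm.trans (pt_eq_add_single_d' hd α β))
      refine Or.inr (Or.inr (Or.inr ⟨?_, hy⟩))
      rw [← hy]; exact h2

/-- Adjacency through one label, forward along `d`. -/
theorem nbr_single_d (hd : d' ≠ d) {U : Set (Site 2 × Fin 2)} {α β : ℤ} (h1 : pt⟪α, β⟫ ∈ Bx)
    (h2 : pt⟪α + 1, β⟫ ∈ Bx) (hU : (pt⟪α, β⟫, d) ∈ U) : pt⟪α + 1, β⟫ ∈ nbr⟪Bx, U, pt⟪α, β⟫⟫ :=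
  ⟨h1, h2, d, Or.inl ⟨(pt_add_single_d hd α β).symm, hU⟩⟩

/-- Adjacency through one label, backward along `d`. -/
theorem nbr_single_d_back (hd : d' ≠ d) {U : Set (Site 2 × Fin 2)} {α β : ℤ} (h1 : pt⟪α + 1, β⟫ ∈ Bx)
    (h2 : pt⟪α, β⟫ ∈ Bx) (hU : (pt⟪α, β⟫, d) ∈ U) : pt⟪α, β⟫ ∈ nbr⟪Bx, U, pt⟪α + 1, β⟫⟫ :=
  ⟨h1, h2, d, Or.inr ⟨(pt_add_single_d hd α β).symm, hU⟩⟩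

/-- Adjacency through one label, forward along `d'`. -/
theorem nbr_single_d' (hd : d' ≠ d) {U : Set (Site 2 × Fin 2)} {α β : ℤ} (h1 : pt⟪α, β⟫ ∈ Bx)
    (h2 : pt⟪α, β + 1⟫ ∈ Bx) (hU : (pt⟪α, β⟫, d') ∈ U) : pt⟪α, β + 1⟫ ∈ nbr⟪Bx, U, pt⟪α, β⟫⟫ :=
  ⟨h1, h2, d', Or.inl ⟨(pt_add_single_d' hd α β).symm, hU⟩⟩

/-- Adjacency through one label, backward along `d'`. -/
theorem nbr_single_d'_back (hd : d' ≠ d) {U : Set (Site 2 × Fin 2)} {α β : ℤ} (h1 : pt⟪α, β + 1⟫ ∈ Bx)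
    (h2 : pt⟪α, β⟫ ∈ Bx) (hU : (pt⟪α, β⟫, d') ∈ U) : pt⟪α, β⟫ ∈ nbr⟪Bx, U, pt⟪α, β + 1⟫⟫ :=
  ⟨h1, h2, d', Or.inr ⟨(pt_add_single_d' hd α β).symm, hU⟩⟩

/-- Membership of a label based at a frame point in the sub-edge set. -/
theorem mem_Tl_iff (hd : d' ≠ d) (α β : ℤ) (d₀ : Fin 2) :
    (pt⟪α, β⟫, d₀) ∈ Tl ↔ d₀ = d ∧ β = 0 ∧ (α = 0 ∨ α = 1 ∨ α = 2) := by
  simp only [Set.mem_insert_iff, Set.mem_singleton_iff, Prod.mk.injEq, pt_eq_iff hd]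
  constructor
  · rintro (⟨⟨h1, h2⟩, h3⟩ | ⟨⟨h1, h2⟩, h3⟩ | ⟨⟨h1, h2⟩, h3⟩) <;> exact ⟨h3, h2, by omega⟩
  · rintro ⟨rfl, rfl, h | h | h⟩ <;> simp [h]

/-- Membership of a label based at a frame point in the interior-label set `F`. -/
theorem mem_Fl_iff (hd : d' ≠ d) (α β : ℤ) (d₀ : Fin 2) :
    (pt⟪α, β⟫, d₀) ∈ Fl ↔ d₀ = d' ∧ (α = 1 ∨ α = 2) ∧ (β = 0 ∨ β = -1) := by
  simp only [Set.mem_insert_iff, Set.mem_singleton_iff, Prod.mk.injEq, pt_eq_iff hd]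
  constructor
  · rintro (⟨⟨h1, h2⟩, h3⟩ | ⟨⟨h1, h2⟩, h3⟩ | ⟨⟨h1, h2⟩, h3⟩ | ⟨⟨h1, h2⟩, h3⟩) <;> exact ⟨h3, by omega, by omega⟩
  · rintro ⟨rfl, h | h, h' | h'⟩ <;> simp [h, h']

/-- **The interior vertices are isolated once `T ∪ F` is closed**: `m_j = pt⟪j, 0⟫` (`j = 1, 2`)
has no neighbour through a label set avoiding `T` and `F`. -/
theorem not_mem_nbr_interior (hd : d' ≠ d) {U : Set (Site 2 × Fin 2)} (hT : ∀ e ∈ Tl, e ∉ U)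
    (hF : ∀ e ∈ Fl, e ∉ U) {j : ℤ} (hj : j = 1 ∨ j = 2) {y : Site 2} : y ∉ nbr⟪Bx, U, pt⟪j, 0⟫⟫ := by
  intro h
  rcases nbr_pt hd h with ⟨hU, -⟩ | ⟨hU, -⟩ | ⟨hU, -⟩ | ⟨hU, -⟩
  · exact hT _ ((mem_Tl_iff hd j 0 d).2 ⟨rfl, rfl, by omega⟩) hU
  · exact hT _ ((mem_Tl_iff hd (j - 1) 0 d).2 ⟨rfl, rfl, by omega⟩) hU
  · exact hF _ ((mem_Fl_iff hd j 0 d').2 ⟨rfl, by omega, Or.inl rfl⟩) hU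
  · exact hF _ ((mem_Fl_iff hd j (0 - 1) d').2 ⟨rfl, by omega, Or.inr (by norm_num)⟩) hU

/-- An isolated vertex outside `L` is not joined to `L`. -/
theorem not_mem_side_of_isolated {U : Set (Site 2 × Fin 2)} {L : Set (Site 2)} {v : Site 2}
    (hv : v ∉ L) (hiso : ∀ y, y ∉ nbr⟪Bx, U, v⟫) : v ∉ side⟪Bx, U, L⟫ := by
  intro h
  rcases side_cases h with h | ⟨p, -, hpv⟩
  · exact hv h
  · exact hiso p (nbr_symm hpv)

/-- The clusters of an isolated vertex is itself. -/
theorem clus_eq_of_isolated {U : Set (Site 2 × Fin 2)} {v : Site 2} (hiso : ∀ y, y ∉ nbr⟪Bx, U, v⟫) :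
    clus⟪Bx, U, v⟫ = {v} := by
  refine Set.Subset.antisymm (clus_subset_of_closed (fun x y hx hxy => ?_) (Set.mem_singleton v))
    (by rintro _ ⟨rfl⟩; exact mem_clus_self _)
  rw [Set.mem_singleton_iff] at hx
  subst hx
  exact absurd hxy (hiso y)

/-! ### Adjacency through the sub-edges only -/

/-- An adjacency through a subset of the sub-edges joins two consecutive vertices of the tuple. -/
theorem nbr_sub_T (hd : d' ≠ d) {A : Set (Site 2 × Fin 2)} (hA : A ⊆ Tl) {x y : Site 2}
    (h : y ∈ nbr⟪Bx, A, x⟫) :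
    ∃ j : ℤ, (j = 0 ∨ j = 1 ∨ j = 2) ∧ (pt⟪j, 0⟫, d) ∈ A ∧
      ((x = pt⟪j, 0⟫ ∧ y = pt⟪j + 1, 0⟫) ∨ (y = pt⟪j, 0⟫ ∧ x = pt⟪j + 1, 0⟫)) := by
  obtain ⟨-, -, d₀, ⟨h1, h2⟩ | ⟨h1, h2⟩⟩ := h
  · have hm := hA h2
    simp only [Set.mem_insert_iff, Set.mem_singleton_iff, Prod.mk.injEq] at hm
    rcases hm with ⟨rfl, hd0⟩ | ⟨rfl, hd0⟩ | ⟨rfl, hd0⟩ <;> rw [hd0] at h1 h2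
    · exact ⟨0, Or.inl rfl, h2, Or.inl ⟨rfl, by rw [h1, pt_add_single_d hd]⟩⟩
    · exact ⟨1, Or.inr (Or.inl rfl), h2, Or.inl ⟨rfl, by rw [h1, pt_add_single_d hd]⟩⟩
    · exact ⟨2, Or.inr (Or.inr rfl), h2, Or.inl ⟨rfl, by rw [h1, pt_add_single_d hd]⟩⟩
  · have hm := hA h2
    simp only [Set.mem_insert_iff, Set.mem_singleton_iff, Prod.mk.injEq] at hm
    rcases hm with ⟨rfl, hd0⟩ | ⟨rfl, hd0⟩ | ⟨rfl, hd0⟩ <;> rw [hd0] at h1 h2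
    · exact ⟨0, Or.inl rfl, h2, Or.inr ⟨rfl, by rw [h1, pt_add_single_d hd]⟩⟩
    · exact ⟨1, Or.inr (Or.inl rfl), h2, Or.inr ⟨rfl, by rw [h1, pt_add_single_d hd]⟩⟩
    · exact ⟨2, Or.inr (Or.inr rfl), h2, Or.inr ⟨rfl, by rw [h1, pt_add_single_d hd]⟩⟩

/-- From `u = pt⟪0, 0⟫`, the sub-edges reach at most `{pt⟪j, 0⟫ | j < k}` if the `k`-th sub-edge
(`k = 0, 1, 2`) is missing; stated as: the initial segment `{pt⟪j, 0⟫ | 0 ≤ j ≤ k}` is closed under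
adjacency through `A ⊆ T` when `(pt⟪k, 0⟫, d) ∉ A`. -/
theorem segment_closed (hd : d' ≠ d) {A : Set (Site 2 × Fin 2)} (hA : A ⊆ Tl) {k : ℤ}
    (hk : (pt⟪k, 0⟫, d) ∉ A) (x y : Site 2) (hx : x ∈ {v : Site 2 | ∃ j : ℤ, 0 ≤ j ∧ j ≤ k ∧ v = pt⟪j, 0⟫})
    (hxy : y ∈ nbr⟪Bx, A, x⟫) : y ∈ {v : Site 2 | ∃ j : ℤ, 0 ≤ j ∧ j ≤ k ∧ v = pt⟪j, 0⟫} := by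
  obtain ⟨i, hi0, hik, rfl⟩ := hx
  obtain ⟨j, hj, hjA, ⟨h1, h2⟩ | ⟨h1, h2⟩⟩ := nbr_sub_T hd hA hxy
  · have hij : i = j := (pt_inj hd h1).1
    subst hij
    refine ⟨i + 1, by omega, ?_, h2⟩
    rcases lt_or_eq_of_le hik with h | rfl
    · omega
    · exact absurd hjA hk
  · have hij : i = j + 1 := (pt_inj hd h2).1
    exact ⟨j, by omega, by omega, h1⟩

/-- If some sub-edge is missing from `A ⊆ T`, then `w = pt⟪3, 0⟫` is not in the `A`-cluster of `u`,
and that cluster consists of vertices `pt⟪j, 0⟫`, `0 ≤ j ≤ 2`. -/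
theorem clus_u_subset (hd : d' ≠ d) {A : Set (Site 2 × Fin 2)} (hA : A ⊆ Tl)
    (hmiss : (pt⟪0, 0⟫, d) ∉ A ∨ (pt⟪1, 0⟫, d) ∉ A ∨ (pt⟪2, 0⟫, d) ∉ A) :
    clus⟪Bx, A, pt⟪0, 0⟫⟫ ⊆ {v : Site 2 | ∃ j : ℤ, 0 ≤ j ∧ j ≤ 2 ∧ v = pt⟪j, 0⟫} := by
  rcases hmiss with hk | hk | hk
  · refine (clus_subset_of_closed (segment_closed hd hA (k := 0) hk) ⟨0, le_rfl, le_rfl, rfl⟩).trans ?_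
    rintro v ⟨j, h0, h1, rfl⟩; exact ⟨j, h0, by omega, rfl⟩
  · refine (clus_subset_of_closed (segment_closed hd hA (k := 1) hk) ⟨0, le_rfl, by norm_num, rfl⟩).trans ?_
    rintro v ⟨j, h0, h1, rfl⟩; exact ⟨j, h0, by omega, rfl⟩
  · exact clus_subset_of_closed (segment_closed hd hA (k := 2) hk) ⟨0, le_rfl, by norm_num, rfl⟩

/-- Symmetrically from `w = pt⟪3, 0⟫`: the final segment `{pt⟪j, 0⟫ | k + 1 ≤ j ≤ 3}` is closed under
adjacency through `A ⊆ T` when `(pt⟪k, 0⟫, d) ∉ A`. -/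
theorem segment_closed' (hd : d' ≠ d) {A : Set (Site 2 × Fin 2)} (hA : A ⊆ Tl) {k : ℤ}
    (hk : (pt⟪k, 0⟫, d) ∉ A) (x y : Site 2) (hx : x ∈ {v : Site 2 | ∃ j : ℤ, k + 1 ≤ j ∧ j ≤ 3 ∧ v = pt⟪j, 0⟫})
    (hxy : y ∈ nbr⟪Bx, A, x⟫) : y ∈ {v : Site 2 | ∃ j : ℤ, k + 1 ≤ j ∧ j ≤ 3 ∧ v = pt⟪j, 0⟫} := by
  obtain ⟨i, hi0, hik, rfl⟩ := hx
  obtain ⟨j, hj, hjA, ⟨h1, h2⟩ | ⟨h1, h2⟩⟩ := nbr_sub_T hd hA hxy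
  · have hij : i = j := (pt_inj hd h1).1
    subst hij
    exact ⟨i + 1, by omega, by omega, h2⟩
  · have hij : i = j + 1 := (pt_inj hd h2).1
    refine ⟨j, ?_, by omega, h1⟩
    rcases lt_or_eq_of_le hi0 with h | h
    · omega
    · exact absurd (by rw [show k = j by omega]; exact hjA) hk

/-- If some sub-edge is missing from `A ⊆ T`, the `A`-cluster of `w` consists of vertices
`pt⟪j, 0⟫`, `1 ≤ j ≤ 3`. -/
theorem clus_w_subset (hd : d' ≠ d) {A : Set (Site 2 × Fin 2)} (hA : A ⊆ Tl)
    (hmiss : (pt⟪0, 0⟫, d) ∉ A ∨ (pt⟪1, 0⟫, d) ∉ A ∨ (pt⟪2, 0⟫, d) ∉ A) :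
    clus⟪Bx, A, pt⟪3, 0⟫⟫ ⊆ {v : Site 2 | ∃ j : ℤ, 1 ≤ j ∧ j ≤ 3 ∧ v = pt⟪j, 0⟫} := by
  rcases hmiss with hk | hk | hk
  · exact clus_subset_of_closed (segment_closed' hd hA (k := 0) hk) ⟨3, by norm_num, le_rfl, rfl⟩
  · refine (clus_subset_of_closed (segment_closed' hd hA (k := 1) hk) ⟨3, by norm_num, le_rfl, rfl⟩).trans ?_
    rintro v ⟨j, h0, h1, rfl⟩; exact ⟨j, by omega, h1, rfl⟩
  · refine (clus_subset_of_closed (segment_closed' hd hA (k := 2) hk) ⟨3, by norm_num, le_rfl, rfl⟩).trans ?_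
    rintro v ⟨j, h0, h1, rfl⟩; exact ⟨j, by omega, h1, rfl⟩

/-! ### The two-sided case -/

/-- **From a crossing through the tuple to the two-sided case.** Let `V⁰` avoid `T ∪ F` (tuple and
its interior labels closed) and suppose `m₁, m₂ ∉ L ∪ R`.  If `V⁰` does not join the sides but
`V⁰ ∪ T` does, then `u ↔ L` and `w ↔ R`, or `w ↔ L` and `u ↔ R` (all in `V⁰`). -/
theorem two_sided_of_joined (hd : d' ≠ d) {V : Set (Site 2 × Fin 2)} (hT : ∀ e ∈ Tl, e ∉ V)
    (hF : ∀ e ∈ Fl, e ∉ V)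
    (hm1 : pt⟪1, 0⟫ ∉ Lx ∧ pt⟪1, 0⟫ ∉ Rx) (hm2 : pt⟪2, 0⟫ ∉ Lx ∧ pt⟪2, 0⟫ ∉ Rx)
    (hno : V ∉ joined⟪Bx, Lx, Rx⟫) (hyes : V ∪ Tl ∈ joined⟪Bx, Lx, Rx⟫) :
    (pt⟪0, 0⟫ ∈ side⟪Bx, V, Lx⟫ ∧ pt⟪3, 0⟫ ∈ side⟪Bx, V, Rx⟫) ∨
      (pt⟪3, 0⟫ ∈ side⟪Bx, V, Lx⟫ ∧ pt⟪0, 0⟫ ∈ side⟪Bx, V, Rx⟫) := by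
  -- the interior vertices are joined to neither side
  have iso : ∀ {j : ℤ}, (j = 1 ∨ j = 2) → ∀ y, y ∉ nbr⟪Bx, V, pt⟪j, 0⟫⟫ :=
    fun hj y => not_mem_nbr_interior hd hT hF hj
  -- one side reaches an end of the tuple
  have reach : ∀ {L' R' : Set (Site 2)}, pt⟪1, 0⟫ ∉ L' → pt⟪2, 0⟫ ∉ L' →
      V ∉ joined⟪Bx, L', R'⟫ → V ∪ Tl ∈ joined⟪Bx, L', R'⟫ →
      pt⟪0, 0⟫ ∈ side⟪Bx, V, L'⟫ ∨ pt⟪3, 0⟫ ∈ side⟪Bx, V, L'⟫ := by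
    intro L' R' h1 h2 hno' hyes'
    by_contra hcon
    push Not at hcon
    obtain ⟨r, hr, l, hl, hlr⟩ := exists_mem_of_joined hyes'
    have hcl : ∀ x y, x ∈ side⟪Bx, V, L'⟫ → y ∈ nbr⟪Bx, V ∪ Tl, x⟫ → y ∈ side⟪Bx, V, L'⟫ := by
      intro x y hx hxy
      rcases nbr_union_iff.1 hxy with hxy | hxy
      · exact side_step hx hxy
      · obtain ⟨j, hj, -, ⟨rfl, -⟩ | ⟨-, rfl⟩⟩ := nbr_sub_T hd Set.Subset.rfl hxy
        · rcases hj with rfl | rfl | rfl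
          · exact absurd hx hcon.1
          · exact absurd hx (not_mem_side_of_isolated h1 (iso (Or.inl rfl)))
          · exact absurd hx (not_mem_side_of_isolated h2 (iso (Or.inr rfl)))
        · rcases hj with rfl | rfl | rfl
          · exact absurd hx (not_mem_side_of_isolated (by simpa using h1) (by simpa using iso (Or.inl rfl)))
          · exact absurd hx (not_mem_side_of_isolated (by simpa using h2) (by simpa using iso (Or.inr rfl)))
          · exact absurd hx (by simpa using hcon.2)
    have hrL : r ∈ side⟪Bx, V, L'⟫ := clus_subset_of_closed hcl (mem_side_of_mem hl) hlr
    exact hno' (joined_of_side hrL (mem_side_of_mem hr))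
  have hL := reach hm1.1 hm2.1 hno hyes
  have hR := reach (L' := Rx) (R' := Lx) hm1.2 hm2.2 (fun h => hno (joined_symm h)) (joined_symm hyes)
  have hu : ¬ (pt⟪0, 0⟫ ∈ side⟪Bx, V, Lx⟫ ∧ pt⟪0, 0⟫ ∈ side⟪Bx, V, Rx⟫) :=
    fun h => hno (joined_of_side h.1 h.2)
  have hw : ¬ (pt⟪3, 0⟫ ∈ side⟪Bx, V, Lx⟫ ∧ pt⟪3, 0⟫ ∈ side⟪Bx, V, Rx⟫) :=
    fun h => hno (joined_of_side h.1 h.2)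
  tauto

/-- **In the two-sided case a proper subset of the sub-edges never joins the sides.** -/
theorem not_joined_of_two_sided (hd : d' ≠ d) {V : Set (Site 2 × Fin 2)} (hT : ∀ e ∈ Tl, e ∉ V)
    (hF : ∀ e ∈ Fl, e ∉ V)
    (hm1 : pt⟪1, 0⟫ ∉ Lx ∧ pt⟪1, 0⟫ ∉ Rx) (hm2 : pt⟪2, 0⟫ ∉ Lx ∧ pt⟪2, 0⟫ ∉ Rx) (hu : pt⟪0, 0⟫ ∉ Rx)
    (hno : V ∉ joined⟪Bx, Lx, Rx⟫)
    (htwo : (pt⟪0, 0⟫ ∈ side⟪Bx, V, Lx⟫ ∧ pt⟪3, 0⟫ ∈ side⟪Bx, V, Rx⟫) ∨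
      (pt⟪3, 0⟫ ∈ side⟪Bx, V, Lx⟫ ∧ pt⟪0, 0⟫ ∈ side⟪Bx, V, Rx⟫))
    {A : Set (Site 2 × Fin 2)} (hA : A ⊆ Tl)
    (hmiss : (pt⟪0, 0⟫, d) ∉ A ∨ (pt⟪1, 0⟫, d) ∉ A ∨ (pt⟪2, 0⟫, d) ∉ A) :
    V ∪ A ∉ joined⟪Bx, Lx, Rx⟫ := by
  have iso : ∀ {j : ℤ}, (j = 1 ∨ j = 2) → ∀ y, y ∉ nbr⟪Bx, V, pt⟪j, 0⟫⟫ :=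
    fun hj y => not_mem_nbr_interior hd hT hF hj
  have hm1L := not_mem_side_of_isolated (U := V) hm1.1 (iso (Or.inl rfl))
  have hm2L := not_mem_side_of_isolated (U := V) hm2.1 (iso (Or.inr rfl))
  intro hyes
  obtain ⟨r, hr, l, hl, hlr⟩ := exists_mem_of_joined hyes
  rcases htwo with ⟨huL, hwR⟩ | ⟨hwL, huR⟩
  · -- closure of `side L ∪ (A-cluster of u)`
    have hwL : pt⟪3, 0⟫ ∉ side⟪Bx, V, Lx⟫ :=
      not_mem_side_of_not_joined (fun h => hno (joined_symm h)) hwR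
    have hsub := clus_u_subset (M := M) (N := N) hd hA hmiss
    have hcl : ∀ x y, x ∈ side⟪Bx, V, Lx⟫ ∪ clus⟪Bx, A, pt⟪0, 0⟫⟫ → y ∈ nbr⟪Bx, V ∪ A, x⟫ →
        y ∈ side⟪Bx, V, Lx⟫ ∪ clus⟪Bx, A, pt⟪0, 0⟫⟫ := by
      intro x y hx hxy
      rcases nbr_union_iff.1 hxy with hxy | hxy
      · rcases hx with hx | hx
        · exact Or.inl (side_step hx hxy)
        · obtain ⟨j, h0, h2, rfl⟩ := hsub hx
          rcases (show j = 0 ∨ j = 1 ∨ j = 2 by omega) with rfl | rfl | rfl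
          · exact Or.inl (side_step huL hxy)
          · exact absurd hxy (iso (Or.inl rfl) y)
          · exact absurd hxy (iso (Or.inr rfl) y)
      · rcases hx with hx | hx
        · obtain ⟨j, hj, -, ⟨rfl, -⟩ | ⟨-, rfl⟩⟩ := nbr_sub_T hd hA hxy
          · rcases hj with rfl | rfl | rfl
            · exact Or.inr (clus_step (mem_clus_self _) hxy)
            · exact absurd hx hm1L
            · exact absurd hx hm2L
          · rcases hj with rfl | rfl | rfl
            · exact absurd hx (by simpa using hm1L)
            · exact absurd hx (by simpa using hm2L)
            · exact absurd hx (by simpa using hwL)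
        · exact Or.inr (clus_step hx hxy)
    have hrZ := clus_subset_of_closed hcl (Or.inl (mem_side_of_mem hl)) hlr
    rcases hrZ with hrL | hrA
    · exact hno (joined_of_side hrL (mem_side_of_mem hr))
    · obtain ⟨j, h0, h2, rfl⟩ := hsub hrA
      rcases (show j = 0 ∨ j = 1 ∨ j = 2 by omega) with rfl | rfl | rfl
      · exact hu hr
      · exact hm1.2 hr
      · exact hm2.2 hr
  · -- closure of `side L ∪ (A-cluster of w)`
    have huL : pt⟪0, 0⟫ ∉ side⟪Bx, V, Lx⟫ :=
      not_mem_side_of_not_joined (fun h => hno (joined_symm h)) huR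
    have hsub := clus_w_subset (M := M) (N := N) hd hA hmiss
    have hcl : ∀ x y, x ∈ side⟪Bx, V, Lx⟫ ∪ clus⟪Bx, A, pt⟪3, 0⟫⟫ → y ∈ nbr⟪Bx, V ∪ A, x⟫ →
        y ∈ side⟪Bx, V, Lx⟫ ∪ clus⟪Bx, A, pt⟪3, 0⟫⟫ := by
      intro x y hx hxy
      rcases nbr_union_iff.1 hxy with hxy | hxy
      · rcases hx with hx | hx
        · exact Or.inl (side_step hx hxy)
        · obtain ⟨j, h0, h2, rfl⟩ := hsub hx
          rcases (show j = 1 ∨ j = 2 ∨ j = 3 by omega) with rfl | rfl | rfl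
          · exact absurd hxy (iso (Or.inl rfl) y)
          · exact absurd hxy (iso (Or.inr rfl) y)
          · exact Or.inl (side_step hwL hxy)
      · rcases hx with hx | hx
        · obtain ⟨j, hj, -, ⟨rfl, -⟩ | ⟨-, rfl⟩⟩ := nbr_sub_T hd hA hxy
          · rcases hj with rfl | rfl | rfl
            · exact absurd hx huL
            · exact absurd hx hm1L
            · exact absurd hx hm2L
          · rcases hj with rfl | rfl | rfl
            · exact absurd hx (by simpa using hm1L)
            · exact absurd hx (by simpa using hm2L)
            · exact Or.inr (clus_step (by simpa using (mem_clus_self _ : pt⟪3, 0⟫ ∈ clus⟪Bx, A, pt⟪3, 0⟫⟫)) hxy)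
        · exact Or.inr (clus_step hx hxy)
    have hrZ := clus_subset_of_closed hcl (Or.inl (mem_side_of_mem hl)) hlr
    rcases hrZ with hrL | hrA
    · exact hno (joined_of_side hrL (mem_side_of_mem hr))
    · obtain ⟨j, h0, h2, rfl⟩ := hsub hrA
      rcases (show j = 1 ∨ j = 2 ∨ j = 3 by omega) with rfl | rfl | rfl
      · exact hm1.2 hr
      · exact hm2.2 hr
      · exact hno (joined_of_side hwL (mem_side_of_mem hr))

end Cone3

/-- **Registered sub-goal `stub_cone3_localA` of stub `stub_cone3`**: once the three sub-edges and
the four interior labels at the interior vertices of a tuple are closed, the interior vertices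
`m₁, m₂` have no open neighbour (`Cone3.not_mem_nbr_interior`) — the isolation fact behind the
two-sided case. -/
theorem stub_cone3_localA : ∀ (M N : ℕ) (b : Site 2) (d d' : Fin 2), d' ≠ d → ∀ U : Set (Site 2 × Fin 2), (∀ e ∈ ({(((3 : ℤ) • b + (0 : ℤ) • (Pi.single d (1 : ℤ) : Site 2) + (0 : ℤ) • (Pi.single d' (1 : ℤ) : Site 2)), d), (((3 : ℤ) • b + (1 : ℤ) • (Pi.single d (1 : ℤ) : Site 2) + (0 : ℤ) • (Pi.single d' (1 : ℤ) : Site 2)), d), (((3 : ℤ) • b + (2 : ℤ) • (Pi.single d (1 : ℤ) : Site 2) + (0 : ℤ) • (Pi.single d' (1 : ℤ) : Site 2)), d)} : Set (Site 2 × Fin 2)), e ∉ U) → (∀ e ∈ ({(((3 : ℤ) • b + (1 : ℤ) • (Pi.single d (1 : ℤ) : Site 2) + (0 : ℤ) • (Pi.single d' (1 : ℤ) : Site 2)), d'), (((3 : ℤ) • b + (1 : ℤ) • (Pi.single d (1 : ℤ) : Site 2) + (-1 : ℤ) • (Pi.single d' (1 : ℤ) : Site 2)), d'), (((3 : ℤ)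 • b + (2 : ℤ) • (Pi.single d (1 : ℤ) : Site 2) + (0 : ℤ) • (Pi.single d' (1 : ℤ) : Site 2)), d'), (((3 : ℤ) • b + (2 : ℤ) • (Pi.single d (1 : ℤ) : Site 2) + (-1 : ℤ) • (Pi.single d' (1 : ℤ) : Site 2)), d')} : Set (Site 2 × Fin 2)), e ∉ U) → ∀ j : ℤ, (j = 1 ∨ j = 2) → ∀ y : Site 2, y ∉ {q : Site 2 | ((3 : ℤ) • b + (j : ℤ) • (Pi.single d (1 : ℤ) : Site 2) + (0 : ℤ) • (Pi.single d' (1 : ℤ) : Site 2)) ∈ KST2023.box M N ∧ q ∈ KST2023.box M N ∧ ∃ e : Fin 2, (q = ((3 : ℤ) • b + (j : ℤ) • (Pi.single d (1 : ℤ) : Site 2) + (0 : ℤ) • (Pi.single d' (1 : ℤ) : Site 2)) + Pi.single e 1 ∧ (((3 : ℤ) • b + (j : ℤ) • (Pi.single d (1 : ℤ) : Site 2) + (0 : ℤ) • (Pi.single d' (1 : ℤ) : Site 2)), e) ∈ U) ∨ (((3 : ℤ) • b + (j : ℤ) • (Pi.single d (1 : ℤ) : Site 2) + (0 : ℤ)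 • (Pi.single d' (1 : ℤ) : Site 2)) = q + Pi.single e 1 ∧ (q, e) ∈ U)} :=
  fun _ _ _ _ _ hd _ hT hF _ hj _ => Cone3.not_mem_nbr_interior hd hT hF hj

end Summit.CriticalPhenomena.CardyFormulaZ2.Cruxes.CriticalPathRSW.FiniteSizeEnvelope

end
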